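import Summits.ValiantsHypothesis.ValiantsHypothesis.Theses.SOSTau
import Literature.Computability.AlgebraicComplexity.SetMultilinear
import Literature.Computability.AlgebraicComplexity.SOSDecompositionProofs
import Literature.Computability.AlgebraicComplexity.ValiantClasses
import Summits.ValiantsHypothesis.ValiantsHypothesis.Theorems.FeketeSOSSOSMagnificationStubPolarisedSOS
import Summits.ValiantsHypothesis.ValiantsHypothesis.Theorems.FeketeSOSSOSMagnificationStubDigitKronecker

/-!
# Line `hex-bilinear-transport` — crux `SOSTau.HutchinsonMagnification` (stmt-ValiantsHypothesis-18749)

STRATEGIST SKELETON (planner-cstrat-stmt-ValiantsHypothesis-18749-b1-0, 2026-08-17), lens TRANSFER: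
the solved sibling is `FeketeSOS.SOSMagnification` (stmt-ValiantsHypothesis-3995), PROVED in tree as
`Theorems/FeketeSOSAssemblyMagnification.sosMagnification` from the seven landed stubs of line
`Cruxes/SOSMagnification/Lines/sml-polarised-transport.lean`.  We port that proof step by step to the
Tavenas–Hutchinson witness `V_n = tavenasV n = Σ_{i<2^n} 2^{2i(2^n−1−i)} X^i` at the levels `n = 4m`, with
the FIXED radix `16` (one hex digit = four bits of the exponent) in place of the growing radix `n + 1`.

What transfers VERBATIM (tree theorems, used by name in the composition below — not stubs):
* `stub_polarisedSOS` (set-multilinear projection + polarisation: `s ≤ 2^{m+1} t` squares, each with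
  `≤ 16^{m/2} + 16^{m−m/2}` block-sub-multilinear monomials),
* `dk_partA` (the inverse Kronecker substitution `y_{(j,h)} ↦ X^{h·16^j}` does not increase supports),
* `exists_bilin_of_two_le_totalDegree` (DST24 Lemma 3.1 steps 1–4: the VSBR middle cut),
* `mem_VNP_ofFintype_iff_holds` / `mem_VP_ofFintype_iff_holds` (bundling).

What does NOT transfer and is replaced (the registered stubs):
* V1 `stub_hexBilinearExponent` — THE NEW STRUCTURE.  Fekete needed Euler's criterion as a Boolean circuit
  (stubs C1–C4, ±1 coefficients).  The Kurtz/Hutchinson coefficient `2^{2i(d−i)}` is astronomically large, but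
  `d = 2^{4m} − 1` is ALL ONES in base 16, so `d − i` is the digitwise complement of `i` and the exponent
  `2 i (d − i) = 2 Σ_{j,l} d_j (15 − d_l) 16^{j+l}` is a BILINEAR FORM in the hex digits of `i`: the coefficient
  is a product of `m²` factors each depending on two digits — a constant-ful circuit of size `O(m²)`, constants
  free in `VNP_ℂ`.  V1 is exactly that arithmetic identity.
* V2 `stub_vnpHexLift` — from V1, the one-hot radix-16 digit lift `(P_m)_m` of `(V_{4m})_m` is a `VNP` family
  (Bürgisser Def. 2.5 = tree `IsVNPFamily`, DIRECTLY from the definition: the Boolean-sum witness is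
  `OneHot(z) · Π_{(j,l)} (Σ_{h,h'} c_{jl}^{h(15−h')} z_{j,h} z_{l,h'}) · Π_j (Σ_h z_{j,h} y_{j,h})`, `c_{jl} = 4^{16^{j+l}}`;
  reindexing by the landed `circuitSum_reindex` / `circuitSum_prod_oneHot`; NO Valiant criterion, NO circuits).
* T2 `stub_kroneckerHex` — the lift is set-multilinear of total degree `m` and the inverse Kronecker map sends
  it to `V_{4m}` over `ℂ` (the landed generic `dk_isSetMultilinear_lift / dk_totalDegree_lift / dk_aeval_lift /
  dk_sum_digit_mul_pow` with `c i = 2^{vExp (4m) i}`, plus `16^m = 2^{4m}` and the `ℤ → ℂ` cast of `tavenasV`).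
* T3 `stub_hexBudget` — the LINEAR-threshold budget: `2^{m+1} T (16^{m/2} + 16^{m−m/2}) < η 16^m` eventually,
  `T = (m+1)(16 L² (m+1)⁴)^{⌊log₂ m⌋}`, `L ≤ m^c + c` (quasi-polynomial · 8^m against 16^m; cf. landed `nat_budget`).
* R `stub_complexToReal` — Dutta 2021 Lemma 10 (ℂ-representation of a real polynomial ⇒ real one, support ×4);
  literally the route's support item `ComplexToRealSOS` (stmt-ValiantsHypothesis-18750), stated BY NAME.

Composition (PROVED, sorry-free): `collapse_of : V1 → V2 → T2 → T3 → SOSTau.CollapseCheapComplexSOS`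
(so the four transport stubs also close support item stmt-ValiantsHypothesis-18751 by name) and
`HutchinsonMagnification_of : V1 → V2 → T2 → T3 → R → SOSTau.HutchinsonMagnification` (the crux BY NAME).

Disproof.lean: none exists for this crux at the time of writing (payload.disproof_path absent); the refuter's
crux-attack (rattack-18749) records "not refutable short of ¬VH ∧ A" and the composition
`ComplexToRealSOS → CollapseCheapComplexSOS → HutchinsonMagnification`, which this line refines.
-/

set_option linter.dupNamespace false

noncomputable section

open MvPolynomial Finset
open Literature.Computability.AlgebraicComplexity
open Summit.ValiantsHypothesis.ValiantsHypothesis.Theorems.FeketeSOSSOSMagnification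
  (stub_polarisedSOS dk_partA)

namespace Summit.ValiantsHypothesis.ValiantsHypothesis.Cruxes.HutchinsonMagnification.HexBilinearTransport

/-! ## Stub statements: the precise `Prop`s (the registered stubs below restate them verbatim, def-free)

Throughout, the level-`m` HEX DIGIT LIFT of `V_{4m}` is written out in full:
`P_m = Σ_{i < 16^m} C (2^{vExp (4m) i}) · Π_{j<m} y_{(j, i / 16^j % 16)} ∈ ℂ[y_{(j,h)} : j < m, h < 16]`. -/

/-- **V1 (the digit-bilinear Kurtz exponent, size M).** For a hex digit vector `d : Fin m → Fin 16` with value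
`i = Σ_j d_j 16^j`, the Tavenas exponent `vExp (4m) i = 2 i (2^{4m} − 1 − i)` equals
`2 Σ_j Σ_l d_j (15 − d_l) 16^{j+l}`.  Why true: `2^{4m} − 1 = Σ_l 15·16^l` and `i ≤` that, so
`2^{4m} − 1 − i = Σ_l (15 − d_l) 16^l` with no borrows; expand the product.  Leans on: `Fin.sum_univ_eq_sum_range`,
`Nat.geomSum_eq` / `geom_sum_mul`, `Finset.sum_mul_sum`, `pow_add`, `pow_mul`. -/
def Stmt.hexBilinearExponent : Prop :=
  ∀ (m : ℕ) (d : Fin m → Fin 16),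
    vExp (4 * m) (∑ j : Fin m, (d j : ℕ) * 16 ^ (j : ℕ)) =
      2 * ∑ j : Fin m, ∑ l : Fin m, ((d j : ℕ) * (15 - (d l : ℕ))) * 16 ^ ((j : ℕ) + (l : ℕ))

/-- **V2 (the hex digit lift of `V_{4m}` is p-definable, size L).** From V1: the family `(P_m)_m` is a `VNP`
family over `ℂ` in the sense of Bürgisser Def. 2.5 (`IsVNPFamily`, variables `Fin m × Fin 16`).  Why true:
with `16 m` Boolean variables `z_{(j,h)}` take the witness
`G_m(y,z) = [Π_j Σ_h z_{j,h}] · [Π_j Π_{h<h'} (1 − z_{j,h} z_{j,h'})] · Π_{j,l} (Σ_{h,h'} (4^{16^{j+l}})^{h(15−h')} z_{j,h} z_{l,h'})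
 · Π_j (Σ_h z_{j,h} y_{j,h})` (for `j = l` read the factor as `Σ_h (4^{16^{2j}})^{h(15−h)} z_{j,h}`): at a Boolean
point it vanishes unless `z` is the one-hot encoding of some `d`, where by V1 it equals
`2^{vExp (4m) i(d)} Π_j y_{(j,d_j)}`; reindex `d ↔ i < 16^m` (landed `circuitSum_reindex`, `circuitSum_prod_oneHot`,
`circuitSum_oneHot_injective`); `complexity G_m = O(m²)` and `deg G_m = O(m²)` by `complexity_finset_sum_le /
complexity_finset_prod_le / complexity_mul_le_holds / complexity_C_holds / complexity_X_holds`; the p-family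
bounds of `P_m` (`16 m` variables, degree `≤ m`) as in landed `totalDegree_fekDigit_le`; assemble level-wise as in
landed `isVNPFamily_of_levelwise'`.  Constants are free (`complexity_C_holds`). -/
def Stmt.vnpHexLift : Prop :=
  Stmt.hexBilinearExponent →
    @IsVNPFamily ℂ _ (fun m => Fin m × Fin 16) _
      (fun m => ∑ i ∈ Finset.range (16 ^ m), C ((2 : ℂ) ^ vExp (4 * m) i) *
        ∏ j : Fin m, X (j, (⟨i / 16 ^ (j : ℕ) % 16, Nat.mod_lt _ (by norm_num)⟩ : Fin 16)))

/-- **T2 (hex digit lift ⟷ inverse Kronecker substitution, size M).** `P_m` is set-multilinear over the `m`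
digit blocks, has total degree exactly `m` (the monomial of `i = 0` has coefficient `2^0 = 1`), and
`κ : y_{(j,h)} ↦ X^{h·16^j}` maps it to `V_{4m}` over `ℂ`.  Why true / leans on: the landed generic lemmas
`dk_isSetMultilinear_lift`, `dk_totalDegree_lift`, `dk_aeval_lift`, `dk_sum_digit_mul_pow` (any coefficient
sequence), then `16^m = 2^{4m}` (`pow_mul`) and `(tavenasV n).map (Int.castRingHom ℂ) = Σ_{i<2^n} C (2^{vExp n i}) X^i`
(as `map_tavenasV`, with `Int.cast_pow`). -/
def Stmt.kroneckerHex : Prop :=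
  ∀ m : ℕ,
    IsSetMultilinear (Prod.fst : Fin m × Fin 16 → Fin m) Finset.univ
      (∑ i ∈ Finset.range (16 ^ m), C ((2 : ℂ) ^ vExp (4 * m) i) *
        ∏ j : Fin m, X (j, (⟨i / 16 ^ (j : ℕ) % 16, Nat.mod_lt _ (by norm_num)⟩ : Fin 16)) :
          MvPolynomial (Fin m × Fin 16) ℂ) ∧
    (∑ i ∈ Finset.range (16 ^ m), C ((2 : ℂ) ^ vExp (4 * m) i) *
        ∏ j : Fin m, X (j, (⟨i / 16 ^ (j : ℕ) % 16, Nat.mod_lt _ (by norm_num)⟩ : Fin 16)) :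
          MvPolynomial (Fin m × Fin 16) ℂ).totalDegree = m ∧
    MvPolynomial.aeval (fun v : Fin m × Fin 16 => (Polynomial.X : Polynomial ℂ) ^ ((v.2 : ℕ) * 16 ^ (v.1 : ℕ)))
        (∑ i ∈ Finset.range (16 ^ m), C ((2 : ℂ) ^ vExp (4 * m) i) *
          ∏ j : Fin m, X (j, (⟨i / 16 ^ (j : ℕ) % 16, Nat.mod_lt _ (by norm_num)⟩ : Fin 16)) :
            MvPolynomial (Fin m × Fin 16) ℂ) =
      (tavenasV (4 * m)).map (Int.castRingHom ℂ)

/-- **T3 (the linear-threshold budget at radix 16, size M).** For every `c` and `η > 0`, eventually in `m`: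
for all `L ≤ m^c + c`, `2^{m+1} · T · (16^{⌊m/2⌋} + 16^{m−⌊m/2⌋}) < η · 2^{4m}` with
`T = (m+1)·((4L(m+1)²)·(4L(m+1)²))^{⌊log₂ m⌋}`.  Why true: `log₂ T = O_c(log² m)` while the left side is
`≤ 2^{3m+4}·T` against `η 2^{4m}`; formal route as in landed `nat_budget`/`mul_sq_le_two_pow`
(`Nat.lt_pow_succ_log_self`, `Nat.pow_log_le_self`, `Nat.lt_two_pow_self`) plus `η > 2^{−K}` for some `K`
(`exists_pow_lt_of_lt_one` / `Real.rpow` free). -/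
def Stmt.hexBudget : Prop :=
  ∀ (c : ℕ) (η : ℝ), 0 < η → ∃ m₀ : ℕ, ∀ m : ℕ, m₀ ≤ m → ∀ L : ℕ, L ≤ m ^ c + c →
    ((2 ^ (m + 1) * ((m + 1) * ((4 * L * (m + 1) ^ 2) * (4 * L * (m + 1) ^ 2)) ^ Nat.log 2 m) *
        (16 ^ (m / 2) + 16 ^ (m - m / 2)) : ℕ) : ℝ) < η * 2 ^ (4 * m)

/-! ## Registered stubs (the ONLY sorries of this file) -/

/-- stub V1 = `Stmt.hexBilinearExponent` (the Kurtz exponent is bilinear in the hex digits; NEW content of the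
transfer — replaces Fekete's Euler-criterion circuit). -/
theorem stub_hexBilinearExponent :
    ∀ (m : ℕ) (d : Fin m → Fin 16),
      vExp (4 * m) (∑ j : Fin m, (d j : ℕ) * 16 ^ (j : ℕ)) =
        2 * ∑ j : Fin m, ∑ l : Fin m, ((d j : ℕ) * (15 - (d l : ℕ))) * 16 ^ ((j : ℕ) + (l : ℕ)) := by
  sorry

/-- stub V2 = `Stmt.vnpHexLift` (V1 ⇒ the hex digit lift family of `V_{4m}` is in `VNP_ℂ`, by Def. 2.5 directly). -/
theorem stub_vnpHexLift :
    (∀ (m : ℕ) (d : Fin m → Fin 16),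
      vExp (4 * m) (∑ j : Fin m, (d j : ℕ) * 16 ^ (j : ℕ)) =
        2 * ∑ j : Fin m, ∑ l : Fin m, ((d j : ℕ) * (15 - (d l : ℕ))) * 16 ^ ((j : ℕ) + (l : ℕ))) →
    @IsVNPFamily ℂ _ (fun m => Fin m × Fin 16) _
      (fun m => ∑ i ∈ Finset.range (16 ^ m), C ((2 : ℂ) ^ vExp (4 * m) i) *
        ∏ j : Fin m, X (j, (⟨i / 16 ^ (j : ℕ) % 16, Nat.mod_lt _ (by norm_num)⟩ : Fin 16))) := by
  sorry

/-- stub T2 = `Stmt.kroneckerHex` (set-multilinearity, exact degree `m`, Kronecker faithfulness onto `V_{4m}`). -/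
theorem stub_kroneckerHex :
    ∀ m : ℕ,
      IsSetMultilinear (Prod.fst : Fin m × Fin 16 → Fin m) Finset.univ
        (∑ i ∈ Finset.range (16 ^ m), C ((2 : ℂ) ^ vExp (4 * m) i) *
          ∏ j : Fin m, X (j, (⟨i / 16 ^ (j : ℕ) % 16, Nat.mod_lt _ (by norm_num)⟩ : Fin 16)) :
            MvPolynomial (Fin m × Fin 16) ℂ) ∧
      (∑ i ∈ Finset.range (16 ^ m), C ((2 : ℂ) ^ vExp (4 * m) i) *
          ∏ j : Fin m, X (j, (⟨i / 16 ^ (j : ℕ) % 16, Nat.mod_lt _ (by norm_num)⟩ : Fin 16)) :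
            MvPolynomial (Fin m × Fin 16) ℂ).totalDegree = m ∧
      MvPolynomial.aeval (fun v : Fin m × Fin 16 => (Polynomial.X : Polynomial ℂ) ^ ((v.2 : ℕ) * 16 ^ (v.1 : ℕ)))
          (∑ i ∈ Finset.range (16 ^ m), C ((2 : ℂ) ^ vExp (4 * m) i) *
            ∏ j : Fin m, X (j, (⟨i / 16 ^ (j : ℕ) % 16, Nat.mod_lt _ (by norm_num)⟩ : Fin 16)) :
              MvPolynomial (Fin m × Fin 16) ℂ) =
        (tavenasV (4 * m)).map (Int.castRingHom ℂ) := by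
  sorry

/-- stub T3 = `Stmt.hexBudget` (quasi-polynomial · 8^m is eventually below η · 16^m). -/
theorem stub_hexBudget :
    ∀ (c : ℕ) (η : ℝ), 0 < η → ∃ m₀ : ℕ, ∀ m : ℕ, m₀ ≤ m → ∀ L : ℕ, L ≤ m ^ c + c →
      ((2 ^ (m + 1) * ((m + 1) * ((4 * L * (m + 1) ^ 2) * (4 * L * (m + 1) ^ 2)) ^ Nat.log 2 m) *
          (16 ^ (m / 2) + 16 ^ (m - m / 2)) : ℕ) : ℝ) < η * 2 ^ (4 * m) := by
  sorry

/-- stub R = the route's support item `ComplexToRealSOS` (stmt-ValiantsHypothesis-18750; Dutta 2021 Lemma 10: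
`Re(a g²) = α(u² − v²) − (β/2)((u+v)² − (u−v)²)`, all four squares supported inside `supp g`), BY NAME. -/
theorem stub_complexToReal :
    Summit.ValiantsHypothesis.ValiantsHypothesis.Theses.SOSTau.ComplexToRealSOS := by
  sorry

/-! ## Composition, part 1 (PROVED): V1 + V2 + T2 + T3 ⇒ support item `CollapseCheapComplexSOS` BY NAME -/

/-- **Cheap complex SOS under the collapse.** `VP_ℂ = VNP_ℂ ⇒` for every `η > 0`, at every level `n = 4m` with
`m` large, `V_n` has a complex weighted SOS representation of support-sum `< η·2^n`: the transferred
Dutta–Saxena–Thierauf chain (VNP-membership of the hex lift, VSBR middle cut, polarised set-multilinear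
projection, inverse Kronecker substitution, budget).  Sorry-free given the four stub statements. -/
theorem collapse_of (hExp : Stmt.hexBilinearExponent) (hVNP : Stmt.vnpHexLift)
    (hDK : Stmt.kroneckerHex) (hBud : Stmt.hexBudget) :
    Summit.ValiantsHypothesis.ValiantsHypothesis.Theses.SOSTau.CollapseCheapComplexSOS := by
  classical
  intro hEq η hη n₀
  -- (1) the hex lift family is in VNP (V2 ∘ V1), hence in VP under the collapse: a complexity exponent `c`
  have h1 := hVNP hExp
  have hVP : @IsVPFamily ℂ _ (fun m => Fin m × Fin 16) _
      (fun m => ∑ i ∈ Finset.range (16 ^ m), C ((2 : ℂ) ^ vExp (4 * m) i) *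
        ∏ j : Fin m, X (j, (⟨i / 16 ^ (j : ℕ) % 16, Nat.mod_lt _ (by norm_num)⟩ : Fin 16))) := by
    have hmem := (mem_VNP_ofFintype_iff_holds (k := ℂ) (σ := fun m => Fin m × Fin 16) _).2 h1
    rw [← hEq] at hmem
    exact (mem_VP_ofFintype_iff_holds (k := ℂ) (σ := fun m => Fin m × Fin 16) _).1 hmem
  obtain ⟨c, hc⟩ := hVP.2
  -- (2) the budget threshold and a large level `m`
  obtain ⟨m₀, hm₀⟩ := hBud c η hη
  obtain ⟨m, hm₀m, hn₀m, h2m⟩ : ∃ m, m₀ ≤ m ∧ n₀ ≤ m ∧ 2 ≤ m :=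
    ⟨max (max m₀ n₀) 2, le_trans (le_max_left _ _) (le_max_left _ _),
      le_trans (le_max_right _ _) (le_max_left _ _), le_max_right _ _⟩
  refine ⟨4 * m, by omega, ?_⟩
  -- the level-`m` lift `P` and the inverse Kronecker substitution `κ`
  set P : MvPolynomial (Fin m × Fin 16) ℂ :=
    ∑ i ∈ Finset.range (16 ^ m), C ((2 : ℂ) ^ vExp (4 * m) i) *
      ∏ j : Fin m, X (j, (⟨i / 16 ^ (j : ℕ) % 16, Nat.mod_lt _ (by norm_num)⟩ : Fin 16)) with hPdef
  set κ : Fin m × Fin 16 → Polynomial ℂ :=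
    fun v => (Polynomial.X : Polynomial ℂ) ^ ((v.2 : ℕ) * 16 ^ (v.1 : ℕ)) with hκdef
  have hcm : complexity P ≤ m ^ c + c := hc m
  have hB := hm₀ m hm₀m (complexity P) hcm
  -- (3) lift facts (T2): set-multilinear, total degree `m`, `κ P = V_{4m}`
  obtain ⟨hsml, hdeg, hfaith⟩ := hDK m
  -- (4) the bilinear middle cut at `j = m / 2` (tree: DST24 Lemma 3.1, steps 1–4)
  have h2deg : 2 ≤ P.totalDegree := by rw [hdeg]; exact h2m
  obtain ⟨-, Lst, hLlen, hLdeg, hLsum⟩ := exists_bilin_of_two_le_totalDegree P h2deg (m / 2)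
  rw [hdeg] at hLlen hLdeg
  set t := Lst.length with ht
  have hPsum : P = ∑ i : Fin t, (Lst[(i : ℕ)]).1 * (Lst[(i : ℕ)]).2 := by
    rw [Fin.sum_univ_fun_getElem Lst fun gh => gh.1 * gh.2]
    exact hLsum.symm
  have hgdeg : ∀ i : Fin t, (Lst[(i : ℕ)]).1.totalDegree ≤ m / 2 := fun i =>
    (hLdeg _ (List.getElem_mem i.2)).1
  have hhdeg : ∀ i : Fin t, (Lst[(i : ℕ)]).2.totalDegree ≤ m - m / 2 := fun i =>
    (hLdeg _ (List.getElem_mem i.2)).2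
  -- (5) set-multilinear projection + polarisation (tree: `stub_polarisedSOS`, radix 16)
  obtain ⟨s, a, q, hs, hrep, hsupp, hbsm⟩ :=
    stub_polarisedSOS m 16 t (m / 2) (m - m / 2) P
      (fun i => (Lst[(i : ℕ)]).1) (fun i => (Lst[(i : ℕ)]).2) (by norm_num) hsml hPsum hgdeg hhdeg
  -- (6) Kronecker transport of the identity and of the supports (tree: `dk_partA`)
  have hGrep : (∑ i, Polynomial.C (a i) * (MvPolynomial.aeval κ (q i)) ^ 2) =
      (tavenasV (4 * m)).map (Int.castRingHom ℂ) := by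
    have h := congrArg (MvPolynomial.aeval κ) hrep
    rw [hfaith, map_sum] at h
    simp only [map_mul, map_pow, MvPolynomial.aeval_C, Polynomial.algebraMap_eq] at h
    exact h.symm
  have hGsupp : ∀ i, (MvPolynomial.aeval κ (q i)).support.card ≤ 16 ^ (m / 2) + 16 ^ (m - m / 2) :=
    fun i => ((dk_partA m 16 (q i) (hbsm i)).1).trans (hsupp i)
  refine ⟨s, a, fun i => MvPolynomial.aeval κ (q i), hGrep, ?_⟩
  -- (7) the support-sum count against the budget
  have hsT : s ≤ 2 ^ (m + 1) * ((m + 1) * ((4 * complexity P * (m + 1) ^ 2) *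
      (4 * complexity P * (m + 1) ^ 2)) ^ Nat.log 2 m) :=
    hs.trans (Nat.mul_le_mul_left _ hLlen)
  have hsum : (∑ i, ((MvPolynomial.aeval κ (q i)).support.card : ℝ)) ≤
      ((2 ^ (m + 1) * ((m + 1) * ((4 * complexity P * (m + 1) ^ 2) *
        (4 * complexity P * (m + 1) ^ 2)) ^ Nat.log 2 m) *
        (16 ^ (m / 2) + 16 ^ (m - m / 2)) : ℕ) : ℝ) := by
    calc (∑ i, ((MvPolynomial.aeval κ (q i)).support.card : ℝ))
        ≤ ∑ _i : Fin s, ((16 ^ (m / 2) + 16 ^ (m - m / 2) : ℕ) : ℝ) :=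
          Finset.sum_le_sum fun i _ => by exact_mod_cast hGsupp i
      _ = (s : ℝ) * ((16 ^ (m / 2) + 16 ^ (m - m / 2) : ℕ) : ℝ) := by
          rw [Finset.sum_const, Finset.card_univ, Fintype.card_fin, nsmul_eq_mul]
      _ ≤ _ := by exact_mod_cast Nat.mul_le_mul_right _ hsT
  exact lt_of_le_of_lt hsum hB

/-! ## Composition, part 2 (PROVED): the five stubs imply the crux BY NAME -/

/-- **The line.** `V1 → V2 → T2 → T3 → R → HutchinsonMagnification`: assume linear real sparse-SOS hardness of
`V_n` with data `(η, n₀)` and, for contradiction, `VP_ℂ = VNP_ℂ`; `collapse_of` at `η/4` yields a level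
`n = 4m ≥ n₀` and a complex representation of `V_n` of support-sum `< (η/4)·2^n`; realify it (R, support ×4,
`((V_n)_ℝ)_ℂ = (V_n)_ℂ` by `Polynomial.map_map`) and feed it to the hardness hypothesis: `η 2^n ≤ 4·(<η/4·2^n)`,
absurd.  Sorry-free. -/
theorem HutchinsonMagnification_of (hExp : Stmt.hexBilinearExponent) (hVNP : Stmt.vnpHexLift)
    (hDK : Stmt.kroneckerHex) (hBud : Stmt.hexBudget)
    (hCR : Summit.ValiantsHypothesis.ValiantsHypothesis.Theses.SOSTau.ComplexToRealSOS) :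
    Summit.ValiantsHypothesis.ValiantsHypothesis.Theses.SOSTau.HutchinsonMagnification := by
  classical
  have hCol := collapse_of hExp hVNP hDK hBud
  rintro ⟨η, hη, n₀, H⟩
  show Literature.Computability.AlgebraicComplexity.VP ℂ ≠
    Literature.Computability.AlgebraicComplexity.VNP ℂ
  intro hEq
  obtain ⟨n, hn, s, a, g, hrep, hlt⟩ := hCol hEq (η / 4) (by positivity) n₀
  have hrep' : (∑ i, Polynomial.C (a i) * g i ^ 2) =
      ((tavenasV n).map (Int.castRingHom ℝ)).map (algebraMap ℝ ℂ) := by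
    rw [hrep, Polynomial.map_map]
    congr 1
  obtain ⟨s', a', g', hreal, hle⟩ := hCR ((tavenasV n).map (Int.castRingHom ℝ)) s a g hrep'
  have key := H n hn s' a' g' hreal
  have hcast : (∑ i, ((g' i).support.card : ℝ)) ≤ 4 * ∑ i, ((g i).support.card : ℝ) := by
    have := (Nat.cast_le (α := ℝ)).mpr hle
    push_cast at this
    exact this
  have h2 : (0 : ℝ) < 2 ^ n := by positivity
  linarith

/-- The crux from the registered stubs (typechecks iff the `Stmt.*` texts are the stub signatures verbatim). -/
theorem HutchinsonMagnification_proof :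
    Summit.ValiantsHypothesis.ValiantsHypothesis.Theses.SOSTau.HutchinsonMagnification :=
  HutchinsonMagnification_of stub_hexBilinearExponent stub_vnpHexLift stub_kroneckerHex stub_hexBudget
    stub_complexToReal

/-! ## Sanity (PROVED, cheap): the definitions compute — V1 at `m = 1` is a finite check -/

/-- V1 at one hex digit: `vExp 4 d = 2 d (15 − d)` for `d < 16` (kernel evaluation). -/
example : ∀ d : Fin 16, vExp (4 * 1) ((d : ℕ) * 16 ^ 0) = 2 * (((d : ℕ) * (15 - (d : ℕ))) * 16 ^ (0 + 0)) := by
  decide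

end Summit.ValiantsHypothesis.ValiantsHypothesis.Cruxes.HutchinsonMagnification.HexBilinearTransport

end
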